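import Summits.QuantumFields.YangMills.Theorems.UnitScaleTiltProp7ExactClause1
import HarnessLib

/-!
# Route `UnitScaleTilt`, crux K1 child «MinimiserStabilityRegPr» (stmt-QuantumFields-19200), skeleton birth_v8 5b4e8467… ∕ v9 (OWNER RULING g24-№3) —
# ROW (E′) «[Balaban1985Variational] (141)–(142): a critical configuration of (5) in the regular fibre (6)(e) MINIMISES over (6)(e)» REDUCED, CHART-FREE AND
# SUP-FREE, TO ONE PER-PAIR INPUT: quadratic growth of the Wilson action at the critical configuration along ONE (4)-representative of every competitor

Cell `ym3-torus`, width seat `ym-ust-19200-w4` (gen 0; task text = E′ of OWNER RULING g24-№3, `route-R3/ym/plan-g24/OWNER-RULING-g24-3-rowEprime.md`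
c7af1cfc71958611).  YM₃ on T³ is a ladder rung (R3), not the Clay problem; nothing here is a claim about the crux `MinimiserStabilityRegPr`, d = 4 or the mass gap,
and the registered row E′ is NOT closed by this file: it is reduced to named analytic inputs (helper landing, `--supports`).

PRINT'S ROUTE (p. 299).  «To see that U_k is a minimum we apply the whole procedure with the configuration U_k instead of U₀ … B = 0 … ⟨A′, J⟩ = 0 (141) …
𝔉(A′) = A(U_k) + ½⟨A′, Δ₁A′⟩ + V(A′) (142).  A second order differential at A′ = 0 is given by the quadratic form above, and it is positive definite.  Hence
A′ = 0 is a minimum … and this implies that U_k is a minimal configuration of the functional A(U)» — i.e. run the expansion AT THE CRITICAL CONFIGURATION ITSELF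
and read minimality over (6)(e) from (a) positivity of the second variation on the constraint ∕ gauge slice, (b) smallness of the higher-order remainder on the
chart domain, (c) the vanishing first variation, (d) the chart covering (6)(e) ([Balaban1985RegularSpaces] Thm 2 = Prop. 2 p. 281).  In the cell's CHART-FREE,
SUP-FREE letters (fleet seat p1 gen 10, `Prop7ExactExpansion` ∕ `Prop7ExactClause1`): (a)+(b)+(d) = the RELATIVE-CURVATURE POINCARÉ inequality
`Σ_b‖Y_b‖² ≤ C_P·L^{2(K−n)}·Σ_p‖R_p − 1‖²` for `Y_b = (W^g)_bU_b^* − 1`, `R_p = W^g(∂p)U(∂p)^*` in ONE representative `W^g`, `g` in print's group (4)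
(`g↓ = 1`), of the competitor `W`; (c) = the first-variation bound `Lin_U(Y) ≥ −C_L·Σ_b‖Y_b‖²` at the reading-R2 critical `U`; and the EXACT action identity
`A(W) − A(U) = Σ_p ½‖R_p − 1‖² + Σ_p ½Re Tr((U(∂p)−1)^*(R_p−1)U(∂p))` (`Prop7ExactExpansion.wilsonAction4_sub_eq_relPlaq`) turns them into
`A(W) = A(W^g) ≥ A(U) + κ·Σ‖Y‖²`, `κ = (1/(2C_P) − 96e)·L^{−2(K−n)} − C_L ≥ 0` (`growth_of_relPoincare_T3`).  These are EXACTLY the per-pair inputs of the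
cell's clause-1 schema (`Prop7ExactExpansion.atMostOneCriticalOrbit_of_relSchema_T3`, one orbit for two CRITICAL configurations) with the competitor's
criticality DROPPED — row E′ asks growth against every competitor of (6)(e), not only against critical ones.

WHAT IS PROVED (sorry-free, no definition; ns `…Theorems.PV3E`).
§1 at a datum `(V, e)` of a member `(F, n, K)`: `isMinOn_regFibrePr_of_le` (the trivial half of E′: a minimiser over (6)(e′) lying in (6)(e), `e ≤ e′`, minimises
   over (6)(e) — monotonicity of (6)); `isMinOn_regFibrePr_of_reprLe` (minimality over (6)(e) ⇐ `A(U) ≤ A(W^v)` for ONE gauge representative of every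
   competitor `W ∈ (6)(e)` — (5) is gauge invariant); **`isMinOn_regFibrePr_of_relSchemaE_T3`** (minimality over (6)(e) ⇐ per competitor ONE (4)-representative with
   the relative-curvature Poincaré inequality and the first-variation bound, `κ ≥ 0`; the E-twin of `atMostOneCriticalOrbit_of_relSchema_T3`);
   `isMinOn_regFibrePr_of_atMostOne_of_isMinOn` (the other classical route: minimality of a critical `W` ⇐ «at most one critical orbit in (6)(e)» ∧ «the
   minimum over (6)(e) is attained», cf. w2's `Prop7PV3CDEAttainment.rowE_regime_of_A_C_att` for the instance from rows A ∧ C ∧ attainment).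
§2 **`stub_PV3E_of_relSchemaE`** — THE E′ TEXT OF RECORD (verbatim conclusion) from ONE displayed uniform hypothesis: for every `L > 1` constants `e₆, C_P > 0`,
   `C_L⁰ ≥ 0` such that for every member, every `0 < e ≤ e₆`, every datum `V`, every reading-R2 critical `U ∈ (6)(e) ∩ 𝔅_k(V)` and every `W ∈ (6)(e) ∩ 𝔅_k(V)`
   some `g` with `g↓ = 1` satisfies (ii′) with `C_P` and (iii) with `C_L = C_L⁰·e·L^{−2(K−n)}` (the shape of the cell's S4 schema); then E′ holds with
   `e₅ = min{e₆, 1/(2C_P(97 + C_L⁰))}`, `a₁'' = 1` — the (7)-datum `ε₁`, the (14)-background `U₀` and the window `L³B₃ε₁ ≤ e` of E′ are not used by this route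
   (it proves the stronger «every R2-critical configuration of (6)(e) minimises over (6)(e), e ≤ e₅(L)», print's statement read over the whole regular fibre).
LOCATED REMARK (for the owner ∕ the route-R pen; not a ruling): the per-pair inputs (ii′) ∧ (iii) for a GENERAL competitor `W ∈ (6)(e)` are what print's own
route supplies ([Balaban1985RegularSpaces] Thm 2 p. 83 asks of the competitor `U′` only (1.34)–(1.35) p. 82 — regularity `U′U₀ ∈ 𝔄_k` in the axial gauge and
closeness of the averages —, the strong regularity (1.33) «(3.35) in [4]» being asked of the BACKGROUND; the positivity of `Δ₁` and the bound on `V(A′)` live at the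
background too); a supplier of the clause-1 inputs that uses criticality of BOTH configurations (e.g. curvature non-concentration of minimisers) does not by
itself discharge row E′.

HONEST SCOPE.  Bookkeeping over `Prop7ExactClause1` and the tree's letters (`regFibrePr`, `IsCritR2`, `descTransf`, `pertVar`); the Poincaré inequality (ii′)
and the first-variation bound (iii) against a general regular competitor remain OPEN analytic inputs (they are the content of rows A ∕ C of v8 read at the
critical background, resp. of the route-R stubs); nothing of [Balaban1985Variational] is asserted; `--supports stmt-QuantumFields-19200`, count-neutral.

References: T. Bałaban, CMP 102 (1985) 277–309 [Balaban1985Variational] ((4)–(6) p.278, (14) p.280, Prop. 2 p.281, (26)–(31) pp.282–283, Prop. 7 and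
(141)–(143) p.299); CMP 99 (1985) 75–102 [Balaban1985RegularSpaces] ((1.33)–(1.35) p.82, Thm 2 p.83).
-/

noncomputable section

open scoped BigOperators Matrix.Norms.L2Operator Matrix

namespace Summit.QuantumFields.YangMills.Theorems.PV3E

open Literature.MathematicalPhysics.QuantumFieldTheory.Balaban1983to89
open Literature.MathematicalPhysics.QuantumFieldTheory.Balaban1983to89.T3ContinuumYM3Torus
open Literature.MathematicalPhysics.QuantumFieldTheory.Balaban1983to89.T3UnitLawDensityEML (ℰp)
open Literature.MathematicalPhysics.QuantumFieldTheory.Balaban1983to89.T3ConstrainedMinimiser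
open Literature.MathematicalPhysics.QuantumFieldTheory.Balaban1983to89.T3PrintedRegularMinimiser (RegPr regFibrePr mem_regFibrePr_iff)
open Literature.MathematicalPhysics.QuantumFieldTheory.Balaban1983to89.T3PrintedRegularOrbits (descTransf)
open Literature.MathematicalPhysics.QuantumFieldTheory.Balaban1983to89.T3PrintedMinimiserExistence (regFibrePr_mono)
open Literature.MathematicalPhysics.QuantumFieldTheory.Balaban1983to89.T3Thm1Carrier
open Literature.MathematicalPhysics.QuantumFieldTheory.Balaban1983to89.T3Thm1CarrierNative (IsCritR2 isCritR2_of_isMinOn)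
open Literature.MathematicalPhysics.QuantumFieldTheory.Balaban1983to89.T3SectALandauChart (CloseAvg)
open Finset
open BlockAveragingEMLLinearisedBackground (pertVar)
open Summit.QuantumFields.YangMills.Theorems.Prop7BlendClause1 (pertVar_eq_mul_star plaq_le_of_regPr)
open Summit.QuantumFields.YangMills.Theorems.Prop7ExactExpansion (growth_of_relPoincare_T3)

/-! ## §1 Minimality over the regular fibre (6)(e) at a datum -/

section Datum

variable (F : T3Family) {n K : ℕ} (h : n ≤ K)

/-- **THE TRIVIAL HALF OF ROW E′** (monotonicity of (6) in the radius): a configuration minimising the Wilson action over (6)(e′) minimises over every smaller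
regular fibre (6)(e), `e ≤ e′`, it lies in. [cite: Balaban1985Variational, (6) p.278] -/
theorem isMinOn_regFibrePr_of_le {e e' : ℝ} (hee' : e ≤ e') (V : GaugeField (F.P n) 0 (Matrix.specialUnitaryGroup (Fin 2) ℂ))
    {W : GaugeField (F.P K) 0 (Matrix.specialUnitaryGroup (Fin 2) ℂ)}
    (hmin : IsMinOn (fun W' : GaugeField (F.P K) 0 (Matrix.specialUnitaryGroup (Fin 2) ℂ) => wilsonAction4 W') (regFibrePr F n K h e' V) W) :
    IsMinOn (fun W' : GaugeField (F.P K) 0 (Matrix.specialUnitaryGroup (Fin 2) ℂ) => wilsonAction4 W') (regFibrePr F n K h e V) W :=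
  hmin.on_subset (regFibrePr_mono F hee' V)

/-- **MINIMALITY OVER (6)(e) FROM ONE GAUGE REPRESENTATIVE PER COMPETITOR**: if every `W ∈ (6)(e) ∩ 𝔅_k(V)` has a gauge transform `W^v` with
`A(U) ≤ A(W^v)`, then `U` minimises the Wilson action over (6)(e) ((5) is gauge invariant, `A(W^v) = A(W)`). [cite: Balaban1985Variational, (4)-(5) p.278] -/
theorem isMinOn_regFibrePr_of_reprLe {e : ℝ} (V : GaugeField (F.P n) 0 (Matrix.specialUnitaryGroup (Fin 2) ℂ))
    (U : GaugeField (F.P K) 0 (Matrix.specialUnitaryGroup (Fin 2) ℂ))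
    (hle : ∀ W : GaugeField (F.P K) 0 (Matrix.specialUnitaryGroup (Fin 2) ℂ), W ∈ regFibrePr F n K h e V →
      ∃ v : GaugeTransf (F.P K) 0 (Matrix.specialUnitaryGroup (Fin 2) ℂ), wilsonAction4 U ≤ wilsonAction4 (GaugeField.gaugeAct v W)) :
    IsMinOn (fun W' : GaugeField (F.P K) 0 (Matrix.specialUnitaryGroup (Fin 2) ℂ) => wilsonAction4 W') (regFibrePr F n K h e V) U := by
  intro W hW
  obtain ⟨v, hv⟩ := hle W hW
  have hA : wilsonAction4 (GaugeField.gaugeAct v W) = wilsonAction4 W := T4WilsonGaugeFlatDirection.wilsonAction_gaugeAct 1 v W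
  show wilsonAction4 U ≤ wilsonAction4 W
  rwa [hA] at hv

/-- **ROW E AT A DATUM FROM THE SUP-FREE PER-PAIR SCHEMA** (the E-twin of the cell's clause-1 schema `Prop7ExactExpansion.atMostOneCriticalOrbit_of_relSchema_T3`,
with the competitor's criticality dropped): let `U ∈ (6)(e) ∩ 𝔅_k(V)`, `e ≥ 0`; if every `W ∈ (6)(e) ∩ 𝔅_k(V)` has a representative `W^g`, `g↓ = 1`, whose
relative field `Y_b = (W^g)_bU_b^* − 1` and relative plaquette field `R_p = W^g(∂p)U(∂p)^*` satisfy (ii′) the RELATIVE-CURVATURE POINCARÉ inequality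
`Σ_b‖Y_b‖² ≤ C_P·L^{2(K−n)}·Σ_p‖R_p − 1‖²` and (iii) the first-variation bound `Lin_U(Y) ≥ −C_L·Σ_b‖Y_b‖²`, and if `κ := (1/(2C_P) − 96e)·L^{−2(K−n)} − C_L ≥ 0`,
then `U` MINIMISES the Wilson action over (6)(e) (`A(W) = A(W^g) ≥ A(U) + κΣ‖Y‖²`, `growth_of_relPoincare_T3`).  Print's (141)–(142) p. 299 read chart-free:
(ii′) = positivity of the second variation + chart covering, (iii) = the vanishing first variation at a critical `U`.
[cite: Balaban1985Variational, (141)-(143) p.299, (26)-(31) pp.282-283] -/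
theorem isMinOn_regFibrePr_of_relSchemaE_T3 {e CP CL : ℝ} (he : 0 ≤ e) (hCP : 0 < CP)
    (V : GaugeField (F.P n) 0 (Matrix.specialUnitaryGroup (Fin 2) ℂ)) {U : GaugeField (F.P K) 0 (Matrix.specialUnitaryGroup (Fin 2) ℂ)}
    (hU : U ∈ regFibrePr F n K h e V)
    (hκ : 0 ≤ (1 / (2 * CP) - 96 * e) * (((F.L : ℝ) ^ (K - n)) ^ 2)⁻¹ - CL)
    (hrepr : ∀ W : GaugeField (F.P K) 0 (Matrix.specialUnitaryGroup (Fin 2) ℂ), W ∈ regFibrePr F n K h e V →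
        ∃ g : GaugeTransf (F.P K) 0 (Matrix.specialUnitaryGroup (Fin 2) ℂ), descTransf F n K h g = (fun _ => 1) ∧
          (∑ b : PBond (F.P K) 0, ‖pertVar U (GaugeField.gaugeAct g W) b‖ ^ 2 ≤
            CP * ((F.L : ℝ) ^ (K - n)) ^ 2 * ∑ p : Plaq (F.P K) 0,
              ‖((GaugeField.plaqHol (GaugeField.gaugeAct g W) p : Matrix.specialUnitaryGroup (Fin 2) ℂ) : Matrix (Fin 2) (Fin 2) ℂ)
                  * star ((GaugeField.plaqHol U p : Matrix.specialUnitaryGroup (Fin 2) ℂ) : Matrix (Fin 2) (Fin 2) ℂ) - 1‖ ^ 2) ∧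
          (-CL * ∑ b : PBond (F.P K) 0, ‖pertVar U (GaugeField.gaugeAct g W) b‖ ^ 2 ≤
            ∑ p : Plaq (F.P K) 0, (1 / 2) * ((((((GaugeField.plaqHol U p : Matrix.specialUnitaryGroup (Fin 2) ℂ) : Matrix (Fin 2) (Fin 2) ℂ)) - 1)ᴴ
              * (((((GaugeField.gaugeAct g W ⟨p.src, p.μ⟩ : Matrix.specialUnitaryGroup (Fin 2) ℂ) : Matrix (Fin 2) (Fin 2) ℂ) * star (U ⟨p.src, p.μ⟩ : Matrix (Fin 2) (Fin 2) ℂ) - 1)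
                  + (U ⟨p.src, p.μ⟩ : Matrix (Fin 2) (Fin 2) ℂ)
                      * (((GaugeField.gaugeAct g W ⟨p.src.shift p.μ, p.ν⟩ : Matrix.specialUnitaryGroup (Fin 2) ℂ) : Matrix (Fin 2) (Fin 2) ℂ) *
                          star (U ⟨p.src.shift p.μ, p.ν⟩ : Matrix (Fin 2) (Fin 2) ℂ) - 1)
                      * star (U ⟨p.src, p.μ⟩ : Matrix (Fin 2) (Fin 2) ℂ)
                  - ((U ⟨p.src, p.μ⟩ * U ⟨p.src.shift p.μ, p.ν⟩ * (U ⟨p.src.shift p.ν, p.μ⟩)⁻¹ : Matrix.specialUnitaryGroup (Fin 2) ℂ) :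
                        Matrix (Fin 2) (Fin 2) ℂ)
                      * (((GaugeField.gaugeAct g W ⟨p.src.shift p.ν, p.μ⟩ : Matrix.specialUnitaryGroup (Fin 2) ℂ) : Matrix (Fin 2) (Fin 2) ℂ) *
                          star (U ⟨p.src.shift p.ν, p.μ⟩ : Matrix (Fin 2) (Fin 2) ℂ) - 1)
                      * star ((U ⟨p.src, p.μ⟩ * U ⟨p.src.shift p.μ, p.ν⟩ * (U ⟨p.src.shift p.ν, p.μ⟩)⁻¹ : Matrix.specialUnitaryGroup (Fin 2) ℂ) :
                        Matrix (Fin 2) (Fin 2) ℂ)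
                  - ((GaugeField.plaqHol U p : Matrix.specialUnitaryGroup (Fin 2) ℂ) : Matrix (Fin 2) (Fin 2) ℂ)
                      * (((GaugeField.gaugeAct g W ⟨p.src, p.ν⟩ : Matrix.specialUnitaryGroup (Fin 2) ℂ) : Matrix (Fin 2) (Fin 2) ℂ) * star (U ⟨p.src, p.ν⟩ : Matrix (Fin 2) (Fin 2) ℂ) - 1)
                      * star ((GaugeField.plaqHol U p : Matrix.specialUnitaryGroup (Fin 2) ℂ) : Matrix (Fin 2) (Fin 2) ℂ))
                * ((GaugeField.plaqHol U p : Matrix.specialUnitaryGroup (Fin 2) ℂ) : Matrix (Fin 2) (Fin 2) ℂ))).trace).re)) :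
    IsMinOn (fun W' : GaugeField (F.P K) 0 (Matrix.specialUnitaryGroup (Fin 2) ℂ) => wilsonAction4 W') (regFibrePr F n K h e V) U := by
  refine isMinOn_regFibrePr_of_reprLe F h V U fun W hW => ?_
  obtain ⟨g, -, hP, hlin⟩ := hrepr W hW
  refine ⟨g, ?_⟩
  have hUr : RegPr F n K e U := ((mem_regFibrePr_iff F).mp hU).2
  have hY : ∀ b : PBond (F.P K) 0, pertVar U (GaugeField.gaugeAct g W) b =
      ((GaugeField.gaugeAct g W b : Matrix.specialUnitaryGroup (Fin 2) ℂ) : Matrix (Fin 2) (Fin 2) ℂ) * star (U b : Matrix (Fin 2) (Fin 2) ℂ) - 1 :=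
    fun b => pertVar_eq_mul_star U (GaugeField.gaugeAct g W) b
  simp only [hY] at hP hlin
  have hG := growth_of_relPoincare_T3 F n K (GaugeField.gaugeAct g W) U he hCP (plaq_le_of_regPr F hUr) hP
  have hS : 0 ≤ ∑ b : PBond (F.P K) 0,
      ‖((GaugeField.gaugeAct g W b : Matrix.specialUnitaryGroup (Fin 2) ℂ) : Matrix (Fin 2) (Fin 2) ℂ) * star (U b : Matrix (Fin 2) (Fin 2) ℂ) - 1‖ ^ 2 :=
    Finset.sum_nonneg fun _ _ => sq_nonneg _
  have hκS := mul_nonneg hκ hS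
  rw [sub_mul] at hκS
  linarith

/-- **THE ATTAINMENT ROUTE AT A DATUM** (the other classical reading of p. 299): if the minimum of the Wilson action over (6)(e), `e > 0`, is ATTAINED and (6)(e)
carries AT MOST ONE critical orbit of print's group (4), then every reading-R2 critical `W ∈ (6)(e) ∩ 𝔅_k(V)` minimises over (6)(e) (the minimiser is itself
critical, lies on the orbit of `W`, and (5) is gauge invariant).  The instance from rows A ∧ C ∧ attainment is w2's `Prop7PV3CDEAttainment.rowE_regime_of_A_C_att`.
[cite: Balaban1985Variational, Prop. 7 p.299, (141)-(142) p.299, (4)-(6) p.278] -/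
theorem isMinOn_regFibrePr_of_atMostOne_of_isMinOn {e : ℝ} (he : 0 < e) (V : GaugeField (F.P n) 0 (Matrix.specialUnitaryGroup (Fin 2) ℂ))
    (h1 : (varProblem3 F n K h).AtMostOneCriticalOrbit e V)
    {Us : GaugeField (F.P K) 0 (Matrix.specialUnitaryGroup (Fin 2) ℂ)} (hUs : Us ∈ regFibrePr F n K h e V)
    (hUsmin : IsMinOn (fun W' : GaugeField (F.P K) 0 (Matrix.specialUnitaryGroup (Fin 2) ℂ) => wilsonAction4 W') (regFibrePr F n K h e V) Us)
    {W : GaugeField (F.P K) 0 (Matrix.specialUnitaryGroup (Fin 2) ℂ)} (hW : W ∈ regFibrePr F n K h e V) (hWcrit : IsCritR2 F n K h V W) :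
    IsMinOn (fun W' : GaugeField (F.P K) 0 (Matrix.specialUnitaryGroup (Fin 2) ℂ) => wilsonAction4 W') (regFibrePr F n K h e V) W := by
  have hUscrit : IsCritR2 F n K h V Us := isCritR2_of_isMinOn he hUs hUsmin
  have hWfib := (mem_regFibrePr_iff F).mp hW
  have hUsfib := (mem_regFibrePr_iff F).mp hUs
  obtain ⟨g, -, hWg⟩ := h1 W Us hWfib.2 hWfib.1 hWcrit hUsfib.2 hUsfib.1 hUscrit
  intro W' hW'
  have hA : wilsonAction4 W = wilsonAction4 Us := by
    rw [hWg]; exact (T4WilsonGaugeFlatDirection.wilsonAction_gaugeAct 1 g W).symm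
  show wilsonAction4 W ≤ wilsonAction4 W'
  rw [hA]
  exact hUsmin hW'

end Datum

/-! ## §2 The E′ text of record from the uniform sup-free per-pair schema -/

/-- **ROW E′ OF SKELETON v9 (OWNER RULING g24-№3; [Balaban1985Variational] (141)–(142) in print's regime) FROM ONE DISPLAYED HYPOTHESIS** — the uniform
sup-free per-pair schema: for every block size `L > 1` there are `e₆, C_P > 0` and `C_L⁰ ≥ 0` such that for every member `(F, n, K)` of the family, every radius
`0 < e ≤ e₆`, every datum `V`, every reading-R2 critical `U ∈ (6)(e) ∩ 𝔅_k(V)` and every competitor `W ∈ (6)(e) ∩ 𝔅_k(V)` SOME representative `W^g`, `g↓ = 1`,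
satisfies (ii′) the relative-curvature Poincaré inequality with constant `C_P` and (iii) the first-variation bound at `U` with `C_L = C_L⁰·e·L^{−2(K−n)}` (the shape
of the cell's S4 schema).  CONCLUSION = the E′ text verbatim, with `e₅ = min{e₆, 1/(2C_P(97 + C_L⁰))}` (so that `κ ≥ 0`) and `a₁'' = 1`; the (7)-datum, the
(14)-background and the window of E′ are idle on this route, which proves print's statement over the whole regular fibre: every R2-critical configuration of
(6)(e), `e ≤ e₅(L)`, minimises over (6)(e). [cite: Balaban1985Variational, (141)-(143) p.299, Prop. 7 p.299, (4)-(7) p.278, (14) p.280] -/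
theorem stub_PV3E_of_relSchemaE
    (hschema : ∀ (L : ℕ), 1 < L → ∃ e₆ CP CL₀ : ℝ, 0 < e₆ ∧ 0 < CP ∧ 0 ≤ CL₀ ∧
      ∀ (F : T3Family), F.L = L → ∀ (n K : ℕ) (hnK : n < K) (e : ℝ) (V : GaugeField (F.P n) 0 (Matrix.specialUnitaryGroup (Fin 2) ℂ))
        (U W : GaugeField (F.P K) 0 (Matrix.specialUnitaryGroup (Fin 2) ℂ)),
        0 < e → e ≤ e₆ → U ∈ regFibrePr F n K hnK.le e V → IsCritR2 F n K hnK.le V U → W ∈ regFibrePr F n K hnK.le e V →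
          ∃ g : GaugeTransf (F.P K) 0 (Matrix.specialUnitaryGroup (Fin 2) ℂ), descTransf F n K hnK.le g = (fun _ => 1) ∧
            (∑ b : PBond (F.P K) 0, ‖pertVar U (GaugeField.gaugeAct g W) b‖ ^ 2 ≤
              CP * ((F.L : ℝ) ^ (K - n)) ^ 2 * ∑ p : Plaq (F.P K) 0,
                ‖((GaugeField.plaqHol (GaugeField.gaugeAct g W) p : Matrix.specialUnitaryGroup (Fin 2) ℂ) : Matrix (Fin 2) (Fin 2) ℂ)
                    * star ((GaugeField.plaqHol U p : Matrix.specialUnitaryGroup (Fin 2) ℂ) : Matrix (Fin 2) (Fin 2) ℂ) - 1‖ ^ 2) ∧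
            (-(CL₀ * e * (((F.L : ℝ) ^ (K - n)) ^ 2)⁻¹) * ∑ b : PBond (F.P K) 0, ‖pertVar U (GaugeField.gaugeAct g W) b‖ ^ 2 ≤
              ∑ p : Plaq (F.P K) 0, (1 / 2) * ((((((GaugeField.plaqHol U p : Matrix.specialUnitaryGroup (Fin 2) ℂ) : Matrix (Fin 2) (Fin 2) ℂ)) - 1)ᴴ
                * (((((GaugeField.gaugeAct g W ⟨p.src, p.μ⟩ : Matrix.specialUnitaryGroup (Fin 2) ℂ) : Matrix (Fin 2) (Fin 2) ℂ) * star (U ⟨p.src, p.μ⟩ : Matrix (Fin 2) (Fin 2) ℂ) - 1)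
                    + (U ⟨p.src, p.μ⟩ : Matrix (Fin 2) (Fin 2) ℂ)
                        * (((GaugeField.gaugeAct g W ⟨p.src.shift p.μ, p.ν⟩ : Matrix.specialUnitaryGroup (Fin 2) ℂ) : Matrix (Fin 2) (Fin 2) ℂ) *
                            star (U ⟨p.src.shift p.μ, p.ν⟩ : Matrix (Fin 2) (Fin 2) ℂ) - 1)
                        * star (U ⟨p.src, p.μ⟩ : Matrix (Fin 2) (Fin 2) ℂ)
                    - ((U ⟨p.src, p.μ⟩ * U ⟨p.src.shift p.μ, p.ν⟩ * (U ⟨p.src.shift p.ν, p.μ⟩)⁻¹ : Matrix.specialUnitaryGroup (Fin 2) ℂ) :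
                          Matrix (Fin 2) (Fin 2) ℂ)
                        * (((GaugeField.gaugeAct g W ⟨p.src.shift p.ν, p.μ⟩ : Matrix.specialUnitaryGroup (Fin 2) ℂ) : Matrix (Fin 2) (Fin 2) ℂ) *
                            star (U ⟨p.src.shift p.ν, p.μ⟩ : Matrix (Fin 2) (Fin 2) ℂ) - 1)
                        * star ((U ⟨p.src, p.μ⟩ * U ⟨p.src.shift p.μ, p.ν⟩ * (U ⟨p.src.shift p.ν, p.μ⟩)⁻¹ : Matrix.specialUnitaryGroup (Fin 2) ℂ) :
                          Matrix (Fin 2) (Fin 2) ℂ)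
                    - ((GaugeField.plaqHol U p : Matrix.specialUnitaryGroup (Fin 2) ℂ) : Matrix (Fin 2) (Fin 2) ℂ)
                        * (((GaugeField.gaugeAct g W ⟨p.src, p.ν⟩ : Matrix.specialUnitaryGroup (Fin 2) ℂ) : Matrix (Fin 2) (Fin 2) ℂ) * star (U ⟨p.src, p.ν⟩ : Matrix (Fin 2) (Fin 2) ℂ) - 1)
                        * star ((GaugeField.plaqHol U p : Matrix.specialUnitaryGroup (Fin 2) ℂ) : Matrix (Fin 2) (Fin 2) ℂ))
                  * ((GaugeField.plaqHol U p : Matrix.specialUnitaryGroup (Fin 2) ℂ) : Matrix (Fin 2) (Fin 2) ℂ))).trace).re)) :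
    ∀ (L : ℕ), 1 < L → ∀ (B₃ : ℝ), 4 < B₃ →
    ∃ e₅ a₁'' : ℝ, 0 < e₅ ∧ 0 < a₁'' ∧ ∀ (i : Idx L) (e ε₁ : ℝ) (V : GaugeField (i.1.1.P i.1.2.1) 0 (Matrix.specialUnitaryGroup (Fin 2) ℂ))
      (U₀ W : GaugeField (i.1.1.P i.1.2.2) 0 (Matrix.specialUnitaryGroup (Fin 2) ℂ)),
      0 < ε₁ → ε₁ ≤ a₁'' → PlaqSmall ε₁ V → (L : ℝ) ^ 3 * B₃ * ε₁ ≤ e → e ≤ e₅ →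
      RegPr i.1.1 i.1.2.1 i.1.2.2 ((L : ℝ) ^ 3 * B₃ * ε₁) U₀ → CloseAvg i.1.1 i.1.2.1 i.1.2.2 i.2.2.le ((L : ℝ) ^ 3 * ε₁) V U₀ →
      W ∈ regFibrePr i.1.1 i.1.2.1 i.1.2.2 i.2.2.le e V → IsCritR2 i.1.1 i.1.2.1 i.1.2.2 i.2.2.le V W →
        IsMinOn (fun W' : GaugeField (i.1.1.P i.1.2.2) 0 (Matrix.specialUnitaryGroup (Fin 2) ℂ) => wilsonAction4 W')
          (regFibrePr i.1.1 i.1.2.1 i.1.2.2 i.2.2.le e V) W := by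
  intro L hL B₃ hB₃
  obtain ⟨e₆, CP, CL₀, he₆, hCP, hCL₀, H⟩ := hschema L hL
  -- `e₅ := min{e₆, 1/(2C_P(97 + C_L⁰))}` makes `κ = (1/(2C_P) − 96e − C_L⁰e)·L^{−2(K−n)} ≥ 0` for every `e ≤ e₅`
  have hD : 0 < 2 * CP * (97 + CL₀) := by positivity
  refine ⟨min e₆ (1 / (2 * CP * (97 + CL₀))), 1, lt_min he₆ (by positivity), one_pos, ?_⟩
  intro i e ε₁ V U₀ W hε₁ _hε₁a _hV hlo hhi _hRU₀ _hclose hW hWcrit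
  obtain ⟨⟨F, n, K⟩, hF, hnK⟩ := i
  have hL0 : (0 : ℝ) < (L : ℝ) := by exact_mod_cast (show 0 < L by omega)
  have he0 : 0 < e := lt_of_lt_of_le (by positivity) hlo
  have he₆' : e ≤ e₆ := hhi.trans (min_le_left _ _)
  have heD : e ≤ 1 / (2 * CP * (97 + CL₀)) := hhi.trans (min_le_right _ _)
  -- `κ ≥ 0`
  have hw : (0 : ℝ) < (((F.L : ℝ) ^ (K - n)) ^ 2)⁻¹ := by
    have : (0 : ℝ) < F.L := by have := F.hL.2; exact_mod_cast (by omega : 0 < F.L)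
    positivity
  have hnum : 0 ≤ 1 / (2 * CP) - 96 * e - CL₀ * e := by
    have h1 : (96 + CL₀) * e ≤ (96 + CL₀) * (1 / (2 * CP * (97 + CL₀))) := mul_le_mul_of_nonneg_left heD (by positivity)
    have h2 : (96 + CL₀) * (1 / (2 * CP * (97 + CL₀))) ≤ 1 / (2 * CP) := by
      rw [mul_one_div, div_le_div_iff₀ hD (by positivity)]
      nlinarith
    nlinarith
  have hκ : 0 ≤ (1 / (2 * CP) - 96 * e) * (((F.L : ℝ) ^ (K - n)) ^ 2)⁻¹ - CL₀ * e * (((F.L : ℝ) ^ (K - n)) ^ 2)⁻¹ := by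
    have := mul_nonneg hnum hw.le
    nlinarith
  exact isMinOn_regFibrePr_of_relSchemaE_T3 F hnK.le he0.le hCP V hW hκ fun W' hW' => H F hF n K hnK e V W W' he0 he₆' hW hWcrit hW'

/-! ## §3 The θ-variant: the first variation bounded against the relative curvature (the robust form for a ROUGH competitor) -/

section Theta

variable (F : T3Family) {n K : ℕ} (h : n ≤ K)

/-- **ROW E AT A DATUM FROM THE θ-VARIANT OF THE SUP-FREE SCHEMA** (E-twin of `Prop7ExactExpansion.atMostOneCriticalOrbit_of_relSchemaTheta_T3`, competitor's
criticality dropped).  For a competitor `W` of (6)(e) that is NOT critical the first-variation pairing `−Σ_cΛ_c·r_c(Y)` at a critical `U` may reach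
`O(e·L^{−(K−n)})·Σ‖Y‖²` — a factor `L^{K−n}` above the per-pair bound (iii) of §1 (fleet seat p1 gen 10, route-R card §2(b): half the `ℓ²`-mass on one comb trunk)
— but stays small against the RELATIVE CURVATURE `Σ_p‖R_p − 1‖²`; so the input to display for row E′ is (iii′) `Lin_U(Y) ≥ −θ·Σ_p‖R_p − 1‖² − C_L·Σ_b‖Y_b‖²`,
`θ ≤ ½`.  With (ii′) and `κ := ((½ − θ)/C_P − 96e)·L^{−2(K−n)} − C_L ≥ 0`, `U` MINIMISES the Wilson action over (6)(e) (`growth_of_relPoincare_theta_T3` + gauge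
invariance of (5)). [cite: Balaban1985Variational, (141)-(143) p.299, (26)-(31) pp.282-283] -/
theorem isMinOn_regFibrePr_of_relSchemaThetaE_T3 {e CP CL θ : ℝ} (he : 0 ≤ e) (hCP : 0 < CP) (hθ : θ ≤ 1 / 2)
    (V : GaugeField (F.P n) 0 (Matrix.specialUnitaryGroup (Fin 2) ℂ)) {U : GaugeField (F.P K) 0 (Matrix.specialUnitaryGroup (Fin 2) ℂ)}
    (hU : U ∈ regFibrePr F n K h e V)
    (hκ : 0 ≤ ((1 / 2 - θ) / CP - 96 * e) * (((F.L : ℝ) ^ (K - n)) ^ 2)⁻¹ - CL)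
    (hrepr : ∀ W : GaugeField (F.P K) 0 (Matrix.specialUnitaryGroup (Fin 2) ℂ), W ∈ regFibrePr F n K h e V →
        ∃ g : GaugeTransf (F.P K) 0 (Matrix.specialUnitaryGroup (Fin 2) ℂ), descTransf F n K h g = (fun _ => 1) ∧
          (∑ b : PBond (F.P K) 0, ‖pertVar U (GaugeField.gaugeAct g W) b‖ ^ 2 ≤
            CP * ((F.L : ℝ) ^ (K - n)) ^ 2 * ∑ p : Plaq (F.P K) 0,
              ‖((GaugeField.plaqHol (GaugeField.gaugeAct g W) p : Matrix.specialUnitaryGroup (Fin 2) ℂ) : Matrix (Fin 2) (Fin 2) ℂ)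
                  * star ((GaugeField.plaqHol U p : Matrix.specialUnitaryGroup (Fin 2) ℂ) : Matrix (Fin 2) (Fin 2) ℂ) - 1‖ ^ 2) ∧
          (-(θ * ∑ p : Plaq (F.P K) 0,
              ‖((GaugeField.plaqHol (GaugeField.gaugeAct g W) p : Matrix.specialUnitaryGroup (Fin 2) ℂ) : Matrix (Fin 2) (Fin 2) ℂ)
                  * star ((GaugeField.plaqHol U p : Matrix.specialUnitaryGroup (Fin 2) ℂ) : Matrix (Fin 2) (Fin 2) ℂ) - 1‖ ^ 2) -
              CL * ∑ b : PBond (F.P K) 0, ‖pertVar U (GaugeField.gaugeAct g W) b‖ ^ 2 ≤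
            ∑ p : Plaq (F.P K) 0, (1 / 2) * ((((((GaugeField.plaqHol U p : Matrix.specialUnitaryGroup (Fin 2) ℂ) : Matrix (Fin 2) (Fin 2) ℂ)) - 1)ᴴ
              * (((((GaugeField.gaugeAct g W ⟨p.src, p.μ⟩ : Matrix.specialUnitaryGroup (Fin 2) ℂ) : Matrix (Fin 2) (Fin 2) ℂ) * star (U ⟨p.src, p.μ⟩ : Matrix (Fin 2) (Fin 2) ℂ) - 1)
                  + (U ⟨p.src, p.μ⟩ : Matrix (Fin 2) (Fin 2) ℂ)
                      * (((GaugeField.gaugeAct g W ⟨p.src.shift p.μ, p.ν⟩ : Matrix.specialUnitaryGroup (Fin 2) ℂ) : Matrix (Fin 2) (Fin 2) ℂ) *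
                          star (U ⟨p.src.shift p.μ, p.ν⟩ : Matrix (Fin 2) (Fin 2) ℂ) - 1)
                      * star (U ⟨p.src, p.μ⟩ : Matrix (Fin 2) (Fin 2) ℂ)
                  - ((U ⟨p.src, p.μ⟩ * U ⟨p.src.shift p.μ, p.ν⟩ * (U ⟨p.src.shift p.ν, p.μ⟩)⁻¹ : Matrix.specialUnitaryGroup (Fin 2) ℂ) :
                        Matrix (Fin 2) (Fin 2) ℂ)
                      * (((GaugeField.gaugeAct g W ⟨p.src.shift p.ν, p.μ⟩ : Matrix.specialUnitaryGroup (Fin 2) ℂ) : Matrix (Fin 2) (Fin 2) ℂ) *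
                          star (U ⟨p.src.shift p.ν, p.μ⟩ : Matrix (Fin 2) (Fin 2) ℂ) - 1)
                      * star ((U ⟨p.src, p.μ⟩ * U ⟨p.src.shift p.μ, p.ν⟩ * (U ⟨p.src.shift p.ν, p.μ⟩)⁻¹ : Matrix.specialUnitaryGroup (Fin 2) ℂ) :
                        Matrix (Fin 2) (Fin 2) ℂ)
                  - ((GaugeField.plaqHol U p : Matrix.specialUnitaryGroup (Fin 2) ℂ) : Matrix (Fin 2) (Fin 2) ℂ)
                      * (((GaugeField.gaugeAct g W ⟨p.src, p.ν⟩ : Matrix.specialUnitaryGroup (Fin 2) ℂ) : Matrix (Fin 2) (Fin 2) ℂ) * star (U ⟨p.src, p.ν⟩ : Matrix (Fin 2) (Fin 2) ℂ) - 1)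
                      * star ((GaugeField.plaqHol U p : Matrix.specialUnitaryGroup (Fin 2) ℂ) : Matrix (Fin 2) (Fin 2) ℂ))
                * ((GaugeField.plaqHol U p : Matrix.specialUnitaryGroup (Fin 2) ℂ) : Matrix (Fin 2) (Fin 2) ℂ))).trace).re)) :
    IsMinOn (fun W' : GaugeField (F.P K) 0 (Matrix.specialUnitaryGroup (Fin 2) ℂ) => wilsonAction4 W') (regFibrePr F n K h e V) U := by
  refine isMinOn_regFibrePr_of_reprLe F h V U fun W hW => ?_
  obtain ⟨g, -, hP, hlin⟩ := hrepr W hW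
  refine ⟨g, ?_⟩
  have hUr : RegPr F n K e U := ((mem_regFibrePr_iff F).mp hU).2
  have hY : ∀ b : PBond (F.P K) 0, pertVar U (GaugeField.gaugeAct g W) b =
      ((GaugeField.gaugeAct g W b : Matrix.specialUnitaryGroup (Fin 2) ℂ) : Matrix (Fin 2) (Fin 2) ℂ) * star (U b : Matrix (Fin 2) (Fin 2) ℂ) - 1 :=
    fun b => pertVar_eq_mul_star U (GaugeField.gaugeAct g W) b
  simp only [hY] at hP hlin
  have hG := Summit.QuantumFields.YangMills.Theorems.Prop7ExactExpansion.growth_of_relPoincare_theta_T3 F n K (GaugeField.gaugeAct g W) U he hCP hθ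
    (plaq_le_of_regPr F hUr) hP hlin
  have hS : 0 ≤ ∑ b : PBond (F.P K) 0,
      ‖((GaugeField.gaugeAct g W b : Matrix.specialUnitaryGroup (Fin 2) ℂ) : Matrix (Fin 2) (Fin 2) ℂ) * star (U b : Matrix (Fin 2) (Fin 2) ℂ) - 1‖ ^ 2 :=
    Finset.sum_nonneg fun _ _ => sq_nonneg _
  have hκS := mul_nonneg hκ hS
  linarith

end Theta

/-! ## §4 The E′ text of record from the uniform θ-schema (the form to supply for a general regular competitor) -/

/-- **ROW E′ OF SKELETON v9 FROM THE UNIFORM θ-SCHEMA** — as `stub_PV3E_of_relSchemaE`, with the first-variation input in its robust form (iii′)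
`Lin_U(Y) ≥ −θ·Σ_p‖R_p − 1‖² − C_L⁰·e·L^{−2(K−n)}·Σ_b‖Y_b‖²` for a constant `θ < ½` (a supplier proving `θ = O(e)` restricts `e₆`): for every `L > 1` constants
`e₆, C_P > 0`, `C_L⁰ ≥ 0`, `θ < ½` such that for every member, every `0 < e ≤ e₆`, every datum `V`, every reading-R2 critical `U ∈ (6)(e) ∩ 𝔅_k(V)` and every
competitor `W ∈ (6)(e) ∩ 𝔅_k(V)` some `g` with `g↓ = 1` satisfies (ii′) and (iii′).  CONCLUSION = the E′ text verbatim, `e₅ = min{e₆, (½ − θ)/(C_P(97 + C_L⁰))}`,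
`a₁'' = 1`. [cite: Balaban1985Variational, (141)-(143) p.299, Prop. 7 p.299, (4)-(7) p.278, (14) p.280] -/
theorem stub_PV3E_of_relSchemaThetaE
    (hschema : ∀ (L : ℕ), 1 < L → ∃ e₆ CP CL₀ θ : ℝ, 0 < e₆ ∧ 0 < CP ∧ 0 ≤ CL₀ ∧ θ < 1 / 2 ∧
      ∀ (F : T3Family), F.L = L → ∀ (n K : ℕ) (hnK : n < K) (e : ℝ) (V : GaugeField (F.P n) 0 (Matrix.specialUnitaryGroup (Fin 2) ℂ))
        (U W : GaugeField (F.P K) 0 (Matrix.specialUnitaryGroup (Fin 2) ℂ)),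
        0 < e → e ≤ e₆ → U ∈ regFibrePr F n K hnK.le e V → IsCritR2 F n K hnK.le V U → W ∈ regFibrePr F n K hnK.le e V →
          ∃ g : GaugeTransf (F.P K) 0 (Matrix.specialUnitaryGroup (Fin 2) ℂ), descTransf F n K hnK.le g = (fun _ => 1) ∧
            (∑ b : PBond (F.P K) 0, ‖pertVar U (GaugeField.gaugeAct g W) b‖ ^ 2 ≤
              CP * ((F.L : ℝ) ^ (K - n)) ^ 2 * ∑ p : Plaq (F.P K) 0,
              ‖((GaugeField.plaqHol (GaugeField.gaugeAct g W) p : Matrix.specialUnitaryGroup (Fin 2) ℂ) : Matrix (Fin 2) (Fin 2) ℂ)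
                  * star ((GaugeField.plaqHol U p : Matrix.specialUnitaryGroup (Fin 2) ℂ) : Matrix (Fin 2) (Fin 2) ℂ) - 1‖ ^ 2) ∧
            (-(θ * ∑ p : Plaq (F.P K) 0,
              ‖((GaugeField.plaqHol (GaugeField.gaugeAct g W) p : Matrix.specialUnitaryGroup (Fin 2) ℂ) : Matrix (Fin 2) (Fin 2) ℂ)
                  * star ((GaugeField.plaqHol U p : Matrix.specialUnitaryGroup (Fin 2) ℂ) : Matrix (Fin 2) (Fin 2) ℂ) - 1‖ ^ 2) -
                CL₀ * e * (((F.L : ℝ) ^ (K - n)) ^ 2)⁻¹ * ∑ b : PBond (F.P K) 0, ‖pertVar U (GaugeField.gaugeAct g W) b‖ ^ 2 ≤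
            ∑ p : Plaq (F.P K) 0, (1 / 2) * ((((((GaugeField.plaqHol U p : Matrix.specialUnitaryGroup (Fin 2) ℂ) : Matrix (Fin 2) (Fin 2) ℂ)) - 1)ᴴ
              * (((((GaugeField.gaugeAct g W ⟨p.src, p.μ⟩ : Matrix.specialUnitaryGroup (Fin 2) ℂ) : Matrix (Fin 2) (Fin 2) ℂ) * star (U ⟨p.src, p.μ⟩ : Matrix (Fin 2) (Fin 2) ℂ) - 1)
                  + (U ⟨p.src, p.μ⟩ : Matrix (Fin 2) (Fin 2) ℂ)
                      * (((GaugeField.gaugeAct g W ⟨p.src.shift p.μ, p.ν⟩ : Matrix.specialUnitaryGroup (Fin 2) ℂ) : Matrix (Fin 2) (Fin 2) ℂ) *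
                          star (U ⟨p.src.shift p.μ, p.ν⟩ : Matrix (Fin 2) (Fin 2) ℂ) - 1)
                      * star (U ⟨p.src, p.μ⟩ : Matrix (Fin 2) (Fin 2) ℂ)
                  - ((U ⟨p.src, p.μ⟩ * U ⟨p.src.shift p.μ, p.ν⟩ * (U ⟨p.src.shift p.ν, p.μ⟩)⁻¹ : Matrix.specialUnitaryGroup (Fin 2) ℂ) :
                        Matrix (Fin 2) (Fin 2) ℂ)
                      * (((GaugeField.gaugeAct g W ⟨p.src.shift p.ν, p.μ⟩ : Matrix.specialUnitaryGroup (Fin 2) ℂ) : Matrix (Fin 2) (Fin 2) ℂ) *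
                          star (U ⟨p.src.shift p.ν, p.μ⟩ : Matrix (Fin 2) (Fin 2) ℂ) - 1)
                      * star ((U ⟨p.src, p.μ⟩ * U ⟨p.src.shift p.μ, p.ν⟩ * (U ⟨p.src.shift p.ν, p.μ⟩)⁻¹ : Matrix.specialUnitaryGroup (Fin 2) ℂ) :
                        Matrix (Fin 2) (Fin 2) ℂ)
                  - ((GaugeField.plaqHol U p : Matrix.specialUnitaryGroup (Fin 2) ℂ) : Matrix (Fin 2) (Fin 2) ℂ)
                      * (((GaugeField.gaugeAct g W ⟨p.src, p.ν⟩ : Matrix.specialUnitaryGroup (Fin 2) ℂ) : Matrix (Fin 2) (Fin 2) ℂ) * star (U ⟨p.src, p.ν⟩ : Matrix (Fin 2) (Fin 2) ℂ) - 1)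
                      * star ((GaugeField.plaqHol U p : Matrix.specialUnitaryGroup (Fin 2) ℂ) : Matrix (Fin 2) (Fin 2) ℂ))
                * ((GaugeField.plaqHol U p : Matrix.specialUnitaryGroup (Fin 2) ℂ) : Matrix (Fin 2) (Fin 2) ℂ))).trace).re)) :
    ∀ (L : ℕ), 1 < L → ∀ (B₃ : ℝ), 4 < B₃ →
    ∃ e₅ a₁'' : ℝ, 0 < e₅ ∧ 0 < a₁'' ∧ ∀ (i : Idx L) (e ε₁ : ℝ) (V : GaugeField (i.1.1.P i.1.2.1) 0 (Matrix.specialUnitaryGroup (Fin 2) ℂ))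
      (U₀ W : GaugeField (i.1.1.P i.1.2.2) 0 (Matrix.specialUnitaryGroup (Fin 2) ℂ)),
      0 < ε₁ → ε₁ ≤ a₁'' → PlaqSmall ε₁ V → (L : ℝ) ^ 3 * B₃ * ε₁ ≤ e → e ≤ e₅ →
      RegPr i.1.1 i.1.2.1 i.1.2.2 ((L : ℝ) ^ 3 * B₃ * ε₁) U₀ → CloseAvg i.1.1 i.1.2.1 i.1.2.2 i.2.2.le ((L : ℝ) ^ 3 * ε₁) V U₀ →
      W ∈ regFibrePr i.1.1 i.1.2.1 i.1.2.2 i.2.2.le e V → IsCritR2 i.1.1 i.1.2.1 i.1.2.2 i.2.2.le V W →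
        IsMinOn (fun W' : GaugeField (i.1.1.P i.1.2.2) 0 (Matrix.specialUnitaryGroup (Fin 2) ℂ) => wilsonAction4 W')
          (regFibrePr i.1.1 i.1.2.1 i.1.2.2 i.2.2.le e V) W := by
  intro L hL B₃ hB₃
  obtain ⟨e₆, CP, CL₀, θ, he₆, hCP, hCL₀, hθ, H⟩ := hschema L hL
  have hθ' : 0 < 1 / 2 - θ := by linarith
  have hD : 0 < CP * (97 + CL₀) := by positivity
  refine ⟨min e₆ ((1 / 2 - θ) / (CP * (97 + CL₀))), 1, lt_min he₆ (by positivity), one_pos, ?_⟩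
  intro i e ε₁ V U₀ W hε₁ _hε₁a _hV hlo hhi _hRU₀ _hclose hW hWcrit
  obtain ⟨⟨F, n, K⟩, hF, hnK⟩ := i
  have hL0 : (0 : ℝ) < (L : ℝ) := by exact_mod_cast (show 0 < L by omega)
  have he0 : 0 < e := lt_of_lt_of_le (by positivity) hlo
  have he₆' : e ≤ e₆ := hhi.trans (min_le_left _ _)
  have heD : e ≤ (1 / 2 - θ) / (CP * (97 + CL₀)) := hhi.trans (min_le_right _ _)
  -- `κ ≥ 0`
  have hw : (0 : ℝ) < (((F.L : ℝ) ^ (K - n)) ^ 2)⁻¹ := by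
    have : (0 : ℝ) < F.L := by have := F.hL.2; exact_mod_cast (by omega : 0 < F.L)
    positivity
  have hnum : 0 ≤ (1 / 2 - θ) / CP - 96 * e - CL₀ * e := by
    have h1 : (96 + CL₀) * e ≤ (96 + CL₀) * ((1 / 2 - θ) / (CP * (97 + CL₀))) := mul_le_mul_of_nonneg_left heD (by positivity)
    have h2 : (96 + CL₀) * ((1 / 2 - θ) / (CP * (97 + CL₀))) ≤ (1 / 2 - θ) / CP := by
      rw [← mul_div_assoc, div_le_div_iff₀ hD hCP]
      nlinarith
    nlinarith
  have hκ : 0 ≤ ((1 / 2 - θ) / CP - 96 * e) * (((F.L : ℝ) ^ (K - n)) ^ 2)⁻¹ - CL₀ * e * (((F.L : ℝ) ^ (K - n)) ^ 2)⁻¹ := by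
    have := mul_nonneg hnum hw.le
    nlinarith
  refine isMinOn_regFibrePr_of_relSchemaThetaE_T3 F hnK.le he0.le hCP hθ.le V hW hκ fun W' hW' => ?_
  obtain ⟨g, hg, hP, hlin⟩ := H F hF n K hnK e V W W' he0 he₆' hW hWcrit hW'
  refine ⟨g, hg, hP, ?_⟩
  simpa only [mul_assoc] using hlin

end Summit.QuantumFields.YangMills.Theorems.PV3E

end
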